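import Summits.CriticalPhenomena.Ising3DConformalLimit.Theorems.ExistsScaleCovariantLimit.Negative.TightnessUniqueness
import Summits.CriticalPhenomena.Ising3DConformalLimit.Theorems.HyperoctahedralRPExistsScaleCovariantLimitRegularityGivesPrecompact
import Summits.CriticalPhenomena.Ising3DConformalLimit.Theses.MirrorHoelderCompactness
import HarnessLib

/-!
# The existence crux IS item 5955 ∧ item 6153 (importable item map)
(crux `ExistsScaleCovariantLimit`, item stmt-CriticalPhenomena-1981, line `Sketch`; registered stub
`stub_cruxIffOrbitPrecompactPointwiseLimit`; lead c3, 2026-08-16)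

`ExistsScaleCovariantLimit` (existence of the full `δ → 0⁺` scaling limit of all critical `ℤ³` Ising correlators with
one continuous scale covariance; route `HyperoctahedralRP` r4, shared by ≥ 14 routes) is EQUIVALENT to the conjunction of
two EXISTING items of other routes:

* item stmt-CriticalPhenomena-5955 `MonotoneRG.OrbitPrecompact` — precompactness of the critical zoom orbit (the
  compactness half; by the landed `stub_uniformRegularity_of_orbitPrecompact` / `stub_regularityGivesPrecompact` it is
  the same statement as item 4658 `UniformRegularity`);
* item stmt-CriticalPhenomena-6153 `MirrorHoelderCompactness.PointwiseLimit` — POINTWISE full-filter convergence of the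
  pinned zoom at every non-coincident configuration (the uniqueness half, with no topology on function spaces).

`⟹`: the crux is a pinned locally-uniform limit (`pinnedLimit_of_crux`), which is a precompact orbit
(`orbitPrecompact_of_pinnedLimit`) and converges pointwise. `⟸`: two locally-uniform cluster points of the pinned zoom
both agree, at every non-coincident configuration, with the pointwise limit of 6153, so the cluster point is unique
and `crux_iff_orbitPrecompact_and_unique` (refuter, landed) concludes. This improves the landed `limitConstruction`
(item 6159: `UniformRegularity → PointwiseLimit → crux`) in its first hypothesis and to an equivalence.
References: elementary topology of locally uniform convergence; H. Duminil-Copin, ICM 2022 §8.4 (the problem). No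
definitions, no `sorry`. [folklore]
-/

noncomputable section

namespace Summit.CriticalPhenomena.Ising3DConformalLimit.Cruxes.ExistsScaleCovariantLimit.TwoHierarchies

open Literature.Probability.LatticeModels Filter Set
open scoped Topology
open Summit.CriticalPhenomena.Ising3DConformalLimit.MoebiusLimitExistsOnlyInteraction (rhoPin IsClusterPoint)
open Summit.CriticalPhenomena.Ising3DConformalLimit.ExistsScaleCovariantLimitNegative
  (pinnedLimit_of_crux orbitPrecompact_of_pinnedLimit crux_iff_orbitPrecompact_and_unique)

/-- **crux ⟹ item 6153** (`PointwiseLimit`): the pinned zoom converges along the full filter locally uniformly, hence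
pointwise; the renormalisation `ρ★` of 6153 is `ρ_pin` (`rhoStar_eq_rhoPin`). [folklore] -/
theorem pointwiseLimit_of_existsScaleCovariantLimit
    (h : Summit.CriticalPhenomena.Ising3DConformalLimit.Theses.HyperoctahedralRP.ExistsScaleCovariantLimit) :
    Summit.CriticalPhenomena.Ising3DConformalLimit.Theses.MirrorHoelderCompactness.PointwiseLimit := by
  obtain ⟨S₀, hlim⟩ := pinnedLimit_of_crux h
  intro n x hx
  rw [rhoStar_eq_rhoPin]
  exact ⟨S₀ n x, (hlim n).tendsto_at hx⟩

/-- **Item 5955 ∧ item 6153 ⟹ uniqueness of the pinned cluster point**: every locally-uniform cluster point of the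
pinned zoom takes, at each non-coincident configuration, the value of the full-filter pointwise limit. [folklore] -/
theorem clusterPoint_eqOn_of_pointwiseLimit
    (hPL : Summit.CriticalPhenomena.Ising3DConformalLimit.Theses.MirrorHoelderCompactness.PointwiseLimit)
    (S S' : CorrFamily 3) (hS : IsClusterPoint S) (hS' : IsClusterPoint S') (n : ℕ) :
    Set.EqOn (S n) (S' n) (NonCoincident 3 n) := by
  intro x hx
  obtain ⟨l, hl⟩ := hPL n x hx
  rw [rhoStar_eq_rhoPin] at hl
  obtain ⟨u, hu, hcS⟩ := hS
  obtain ⟨u', hu', hcS'⟩ := hS'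
  have e1 : S n x = l := tendsto_nhds_unique ((hcS n).tendsto_at hx) (hl.comp hu)
  have e2 : S' n x = l := tendsto_nhds_unique ((hcS' n).tendsto_at hx) (hl.comp hu')
  rw [e1, e2]

/-- **THE EXISTENCE CRUX IS ITEM 5955 ∧ ITEM 6153** (registered stub `stub_cruxIffOrbitPrecompactPointwiseLimit` of
line `Sketch`): `ExistsScaleCovariantLimit ⟺ MonotoneRG.OrbitPrecompact ∧ MirrorHoelderCompactness.PointwiseLimit`.
[folklore] -/
theorem stub_cruxIffOrbitPrecompactPointwiseLimit :
    Summit.CriticalPhenomena.Ising3DConformalLimit.Theses.HyperoctahedralRP.ExistsScaleCovariantLimit ↔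
    (Summit.CriticalPhenomena.Ising3DConformalLimit.Theses.MonotoneRG.OrbitPrecompact ∧
      Summit.CriticalPhenomena.Ising3DConformalLimit.Theses.MirrorHoelderCompactness.PointwiseLimit) := by
  constructor
  · intro h
    obtain ⟨S₀, hlim⟩ := pinnedLimit_of_crux h
    exact ⟨orbitPrecompact_of_pinnedLimit hlim, pointwiseLimit_of_existsScaleCovariantLimit h⟩
  · rintro ⟨hpc, hPL⟩
    exact crux_iff_orbitPrecompact_and_unique.2 ⟨hpc, clusterPoint_eqOn_of_pointwiseLimit hPL⟩

/-- The same item map read from route `MonotoneRG`'s side: its target (`MonotoneRG.ExistsScaleCovariantLimit`, the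
shared decl) ⟺ its compactness crux 5955 ∧ item 6153. [folklore] -/
theorem monotoneRG_target_iff_orbitPrecompact_and_pointwiseLimit :
    Summit.CriticalPhenomena.Ising3DConformalLimit.Theses.MonotoneRG.ExistsScaleCovariantLimit ↔
    (Summit.CriticalPhenomena.Ising3DConformalLimit.Theses.MonotoneRG.OrbitPrecompact ∧
      Summit.CriticalPhenomena.Ising3DConformalLimit.Theses.MirrorHoelderCompactness.PointwiseLimit) :=
  stub_cruxIffOrbitPrecompactPointwiseLimit

end Summit.CriticalPhenomena.Ising3DConformalLimit.Cruxes.ExistsScaleCovariantLimit.TwoHierarchies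

end
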